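/-
Copyright (c) 2026 the pub-hodgecm-mathlib formalisation cell (harness21).  Prover seat hodgecm-mathlib-F0P3a-p08 (g18): «S3-ram» seeding wave (LEAD F0P3a-plan (g12)
T11-57 (1); owner p06 (g15)), row (n1) «RANK-ram NEGATIVE LEMMA»; 2026-09-01.
-/
import Literature.NumberTheory.Automorphic.UnitaryThreeUnipotentClassesRamifiedPlace   -- ★ p846845 (this seat): the place dress (brings ★ p846834, ★ p846484 `v_conj_cornerUnipotent_sub_one_apply`, ★ `conj_cornerUnipotent_sub_one_mul_self`, `galAdicCompletionMap` currency)
import HarnessLib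

/-!
# Valuation-defined level pieces cannot separate the two transvection classes of `U(3)` at a tamely ramified place (the NEGATIVE lemma behind the
# residue-square-class pieces of the ramified RANK matrix)

Topic `NumberTheory/Automorphic`; namespace `Literature.NumberTheory.Automorphic.UnitaryGroup`.  THEOREMS ONLY (no definition, no instance, no notation, no named fact,
no `sorry`); kernel lane `--supports stmt-HodgeConjecture-24833`.  Cell `pub/hodgecm-mathlib` (D-0151), crux H413; «S3-ram» seeding wave, row **(n1)** (LEAD T11-57 (1),
mechanism as corrected by A-p19 (g26) 21:36:54Z ③): the typed reason why the RANK-ram head ★ p846850 (`UnipotentOrbitalIntegralLevelPiecesRamifiedCM`) indexes its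
transvection columns by the residue-square-class pieces of ★ p846824 and NOT by the level pieces `K(1) ∖ K(2)`, `K ∖ K(1)` of the inert head ★ p846543.

THE MATHEMATICS.  Over a valued field `K` with an isometric involution `σ` and the split form `J₀ = antidiag(1,1,1)`, for `k ∈ U(σ, J₀)` the entry formula (★ p846484)
`(k·n(t)·k⁻¹ − 1)_{ab} = t · k_{a0} · σ(k_{rev b, 0})` shows `k n(t) k⁻¹ − 1 = t · C(k)` with `C(k)` INDEPENDENT of `t`; hence (§1) the matrix of VALUATIONS of
`k n(t) k⁻¹ − 1` depends on `t` only through `|t|`, and `(k n(t) k⁻¹ − 1)² = 0` for every `t` (★ `conj_cornerUnipotent_sub_one_mul_self`).  At a tamely ramified place the two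
transvection classes are `[n(ϖ)]` and `[n(εϖ)]` with `|ε| = 1` (★ p846834∕p846845), so `|ϖ| = |εϖ|`: (§2) EVERY function of `x` that factors through the valuations of the
entries of `x − 1` and of `(x − 1)²` — every «level piece» of the inert RANK table, and every Boolean combination of such — takes the SAME value at `k n(ϖ) k⁻¹` and
`k n(εϖ) k⁻¹` for EVERY `k ∈ U(σ, J₀)`, i.e. pointwise along the common centraliser quotient.  (§3) Consequently, for any «orbital functional» `Φ` that assigns equal values to
two elements whose conjugates carry pointwise-equal integrands (canonical orbital integrals do, the two centralisers being equal), the matrix `(Φ(g_j)(u_i))` of such pieces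
over any index set containing both classes has two equal rows: `det = 0` (Mathlib `Matrix.det_zero_of_row_eq`).  REMARK (A-p19 ③): in odd rank there is no similitude of `J₀`
with a non-norm multiplier (`N(det g) = c³`), so the degeneration is NOT explained by an outer similitude `diag(ε,1,1)`; the valuation mechanism above is the correct one.
HONEST LABEL: HC_CM is proved only modulo the 2 remaining named inputs (hLiu418 24832, h413 24833) until rung 0 closes; nothing printed is asserted here.

## References
* [Rogawski1990] J. D. Rogawski, *Automorphic Representations of Unitary Groups in Three Variables* (1990), §3.9 p. 32 (classes `t mod N E^×`), §8.1 p. 112.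
* [Serre1979] J.-P. Serre, *Local Fields*, GTM 67 (1979), Ch. V §3 Cor. 2 p. 86.
-/

set_option autoImplicit false

noncomputable section

open scoped Matrix MatrixGroups Valued WithZero
open Matrix NumberField IsDedekindDomain

namespace Literature.NumberTheory.Automorphic.UnitaryGroup

open Literature.NumberTheory.Automorphic.HermitianLattice Literature.NumberTheory.Automorphic.UnitaryLatticeTree

/-! ## §1 The valuation matrix of a transvection conjugate depends on `t` only through `|t|` -/

section Generic

variable {K : Type*} [Field K] [Valued K ℤᵐ⁰] (σ : K →+* K)

/-- **EQUAL INVARIANT VALUATION ⇒ EQUAL VALUATION MATRICES, for every conjugator**: if `|t| = |t′|` then for every `k ∈ U(σ, J₀)` and all `(a, b)`,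
`|(k n(t) k⁻¹ − 1)_{ab}| = |(k n(t′) k⁻¹ − 1)_{ab}|` (entry formula ★ `v_conj_cornerUnipotent_sub_one_apply`). [cite: Rogawski1990, §3.9 p. 32] -/
theorem v_conj_cornerUnipotent_sub_one_apply_eq_of_v_eq (hvσ : ∀ a, Valued.v (σ a) = Valued.v a) {t t' : K} (ht : Valued.v t = Valued.v t')
    {u u' k : GL (Fin 3) K} (hu : (u : Matrix (Fin 3) (Fin 3) K) = !![1, 0, t; 0, 1, 0; 0, 0, 1])
    (hu' : (u' : Matrix (Fin 3) (Fin 3) K) = !![1, 0, t'; 0, 1, 0; 0, 0, 1]) (hk : k ∈ unitaryGroupOfForm σ ((StdForm.antidiagonal 3).over K)) (a b : Fin 3) :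
    Valued.v ((((k * u * k⁻¹ : GL (Fin 3) K) : Matrix (Fin 3) (Fin 3) K) - 1) a b) =
      Valued.v ((((k * u' * k⁻¹ : GL (Fin 3) K) : Matrix (Fin 3) (Fin 3) K) - 1) a b) := by
  rw [v_conj_cornerUnipotent_sub_one_apply σ hvσ hu hk, v_conj_cornerUnipotent_sub_one_apply σ hvσ hu' hk, ht]

omit [Valued K ℤᵐ⁰] in
/-- The squares agree too — both vanish: `(k n(t) k⁻¹ − 1)² = 0 = (k n(t′) k⁻¹ − 1)²` (★ `conj_cornerUnipotent_sub_one_mul_self`). [cite: Rogawski1990, §3.9 p. 32] -/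
theorem conj_cornerUnipotent_sub_one_sq_eq {t t' : K} {u u' : GL (Fin 3) K} (hu : (u : Matrix (Fin 3) (Fin 3) K) = !![1, 0, t; 0, 1, 0; 0, 0, 1])
    (hu' : (u' : Matrix (Fin 3) (Fin 3) K) = !![1, 0, t'; 0, 1, 0; 0, 0, 1]) (k : GL (Fin 3) K) :
    (((k * u * k⁻¹ : GL (Fin 3) K) : Matrix (Fin 3) (Fin 3) K) - 1) * (((k * u * k⁻¹ : GL (Fin 3) K) : Matrix (Fin 3) (Fin 3) K) - 1) =
      (((k * u' * k⁻¹ : GL (Fin 3) K) : Matrix (Fin 3) (Fin 3) K) - 1) * (((k * u' * k⁻¹ : GL (Fin 3) K) : Matrix (Fin 3) (Fin 3) K) - 1) := by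
  rw [conj_cornerUnipotent_sub_one_mul_self hu, conj_cornerUnipotent_sub_one_mul_self hu']

/-! ## §2 Valuation-defined pieces take equal values along the two classes, pointwise in the conjugator -/

/-- **VALUATION-DEFINED PIECES DO NOT SEE `t` BEYOND `|t|`**: any `g : GL₃(K) → β` that factors through the valuations of the entries of `x − 1` and of `(x − 1)²` (the shape of
EVERY level piece of the inert RANK table ★ p846543 — `K(2)`, `K(1) ∖ K(2)`, `K ∖ K(1)`, the residually-regular piece — and of any Boolean combination of them) satisfies
`g (k n(t) k⁻¹) = g (k n(t′) k⁻¹)` for every `k ∈ U(σ, J₀)` whenever `|t| = |t′|`. [cite: Rogawski1990, §3.9 p. 32; §8.1 p. 112] -/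
theorem apply_conj_cornerUnipotent_eq_of_factorsThroughValuations (hvσ : ∀ a, Valued.v (σ a) = Valued.v a) {β : Type*} (g : GL (Fin 3) K → β)
    (hg : ∀ x y : GL (Fin 3) K,
      (∀ a b, Valued.v ((((x : Matrix (Fin 3) (Fin 3) K)) - 1) a b) = Valued.v ((((y : Matrix (Fin 3) (Fin 3) K)) - 1) a b)) →
      (∀ a b, Valued.v (((((x : Matrix (Fin 3) (Fin 3) K)) - 1) * (((x : Matrix (Fin 3) (Fin 3) K)) - 1)) a b) =
        Valued.v (((((y : Matrix (Fin 3) (Fin 3) K)) - 1) * (((y : Matrix (Fin 3) (Fin 3) K)) - 1)) a b)) → g x = g y)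
    {t t' : K} (ht : Valued.v t = Valued.v t') {u u' : GL (Fin 3) K} (hu : (u : Matrix (Fin 3) (Fin 3) K) = !![1, 0, t; 0, 1, 0; 0, 0, 1])
    (hu' : (u' : Matrix (Fin 3) (Fin 3) K) = !![1, 0, t'; 0, 1, 0; 0, 0, 1]) {k : GL (Fin 3) K}
    (hk : k ∈ unitaryGroupOfForm σ ((StdForm.antidiagonal 3).over K)) :
    g (k * u * k⁻¹) = g (k * u' * k⁻¹) :=
  hg _ _ (v_conj_cornerUnipotent_sub_one_apply_eq_of_v_eq σ hvσ ht hu hu' hk) fun a b => by rw [conj_cornerUnipotent_sub_one_sq_eq hu hu' k]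

/-! ## §3 The determinant of a valuation-defined piece matrix vanishes on any index set containing both classes -/

/-- **THE NEGATIVE LEMMA**: let `Φ` be any «orbital functional» on representatives with the natural invariance «if `f(k x k⁻¹) = f(k y k⁻¹)` for all `k ∈ U(σ,J₀)` then
`Φ f x = Φ f y`» (canonical orbital integrals of two elements with the same centraliser satisfy it), let the pieces `g_j` factor through the valuations of `x − 1` and
`(x − 1)²`, and let the representatives `rep` contain `n(t)` and `n(t′)` with `|t| = |t′|` at two distinct indices.  Then the matrix `(Φ (g_j) (rep_i))_{i j}` has two
equal rows, so its determinant VANISHES — at a tamely ramified place (`t = ϖ`, `t′ = εϖ`, `|ε| = 1`) the inert level-piece recipe of ★ p846543 cannot give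
`det ≠ 0`; the residue-square-class pieces of ★ p846824 are needed. [cite: Rogawski1990, §8.1 p. 112; §3.9 p. 32] -/
theorem det_orbitalFunctional_pieces_eq_zero (hvσ : ∀ a, Valued.v (σ a) = Valued.v a) {ι : Type*} [Fintype ι] [DecidableEq ι]
    (Φ : (GL (Fin 3) K → ℂ) → GL (Fin 3) K → ℂ)
    (hΦ : ∀ (f : GL (Fin 3) K → ℂ) (x y : GL (Fin 3) K),
      (∀ k : GL (Fin 3) K, k ∈ unitaryGroupOfForm σ ((StdForm.antidiagonal 3).over K) → f (k * x * k⁻¹) = f (k * y * k⁻¹)) → Φ f x = Φ f y)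
    (g : ι → GL (Fin 3) K → ℂ)
    (hg : ∀ j, ∀ x y : GL (Fin 3) K,
      (∀ a b, Valued.v ((((x : Matrix (Fin 3) (Fin 3) K)) - 1) a b) = Valued.v ((((y : Matrix (Fin 3) (Fin 3) K)) - 1) a b)) →
      (∀ a b, Valued.v (((((x : Matrix (Fin 3) (Fin 3) K)) - 1) * (((x : Matrix (Fin 3) (Fin 3) K)) - 1)) a b) =
        Valued.v (((((y : Matrix (Fin 3) (Fin 3) K)) - 1) * (((y : Matrix (Fin 3) (Fin 3) K)) - 1)) a b)) → g j x = g j y)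
    (rep : ι → GL (Fin 3) K) {i₀ i₁ : ι} (hi : i₀ ≠ i₁) {t t' : K} (ht : Valued.v t = Valued.v t')
    (h₀ : ((rep i₀ : GL (Fin 3) K) : Matrix (Fin 3) (Fin 3) K) = !![1, 0, t; 0, 1, 0; 0, 0, 1])
    (h₁ : ((rep i₁ : GL (Fin 3) K) : Matrix (Fin 3) (Fin 3) K) = !![1, 0, t'; 0, 1, 0; 0, 0, 1]) :
    (Matrix.of fun i j => Φ (g j) (rep i)).det = 0 := by
  refine Matrix.det_zero_of_row_eq hi (funext fun j => ?_)
  rw [Matrix.of_apply, Matrix.of_apply]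
  exact hΦ (g j) (rep i₀) (rep i₁) fun k hk => apply_conj_cornerUnipotent_eq_of_factorsThroughValuations σ hvσ (g j) (hg j) ht h₀ h₁ hk

/-- The case of the two ramified transvection representatives `n(ϖ)`, `n(εϖ)` with `|ε| = 1`: `|εϖ| = |ϖ|`. [cite: Rogawski1990, §3.9 p. 32] -/
theorem v_mul_eq_of_v_eq_one {ε : K} (hε : Valued.v ε = 1) (ϖ : K) : Valued.v (ε * ϖ) = Valued.v ϖ := by
  rw [map_mul, hε, one_mul]

end Generic

/-! ## §4 At a tamely ramified place of a quadratic extension of number fields -/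

section Place

variable {F : Type} (E : Type) [Field F] [NumberField F] [Field E] [NumberField E] [Algebra F E] [Algebra.IsQuadraticExtension F E]
  (c : E ≃ₐ[F] E) (v : HeightOneSpectrum (𝓞 F)) (w : PlacesOver E v) (hw : c • w.1 = w.1)

omit [NumberField F] [Algebra.IsQuadraticExtension F E] in
/-- **AT A TAMELY RAMIFIED PLACE THE TWO TRANSVECTION CLASSES `[n(ϖ)]`, `[n(εϖ)]` (★ p846845, `|ε|_w = 1`) HAVE IDENTICAL VALUATION MATRICES ALONG EVERY CONJUGATOR**
`k ∈ U(σ_w, J₀)(E_w)`: `|(k n(εϖ) k⁻¹ − 1)_{ab}|_w = |(k n(ϖ) k⁻¹ − 1)_{ab}|_w`. [cite: Rogawski1990, §3.9 p. 32; §8.1 p. 112] -/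
theorem v_conj_cornerUnipotent_sub_one_apply_eq_of_place {ϖ ε : w.1.adicCompletion E} (hε : Valued.v ε = 1)
    {u u' k : GL (Fin 3) (w.1.adicCompletion E)} (hu : (u : Matrix (Fin 3) (Fin 3) (w.1.adicCompletion E)) = !![1, 0, ϖ; 0, 1, 0; 0, 0, 1])
    (hu' : (u' : Matrix (Fin 3) (Fin 3) (w.1.adicCompletion E)) = !![1, 0, ε * ϖ; 0, 1, 0; 0, 0, 1])
    (hk : k ∈ unitaryGroupOfForm (galAdicCompletionMap (L := E) c hw) ((StdForm.antidiagonal 3).over (w.1.adicCompletion E))) (a b : Fin 3) :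
    Valued.v ((((k * u' * k⁻¹ : GL (Fin 3) (w.1.adicCompletion E)) : Matrix (Fin 3) (Fin 3) (w.1.adicCompletion E)) - 1) a b) =
      Valued.v ((((k * u * k⁻¹ : GL (Fin 3) (w.1.adicCompletion E)) : Matrix (Fin 3) (Fin 3) (w.1.adicCompletion E)) - 1) a b) :=
  v_conj_cornerUnipotent_sub_one_apply_eq_of_v_eq (galAdicCompletionMap (L := E) c hw) (valued_galAdicCompletionMap E c hw)
    (v_mul_eq_of_v_eq_one hε ϖ) hu' hu hk a b

end Place

end Literature.NumberTheory.Automorphic.UnitaryGroup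

end
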